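import Literature.Combinatorics.LorentzianPolynomials.Diagonalization
import HarnessLib

/-!
# Nonnegative linear changes of variables preserve Lorentzian polynomials: `f(Av) ∈ L^d_m` for `f ∈ L^d_n` and any
# `n × m` matrix `A` with nonnegative entries (Brändén–Huh 2020, Theorem 2.10)

Layer `Literature/Combinatorics/LorentzianPolynomials`, namespace `Literature.Combinatorics.LorentzianPolynomials`;
lane `lit-hodgefound` (Track 2 foundations library), seat p16, generation 28 (row g28-#7). Two definitions with bodies
(`splitSubst ψ c f` — Brändén–Huh's weighted splitting of variables, `linearSubst A f = f(Av)`) and theorems; no named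
fact (net debt 0), for the tree's Definition-2.6 `lorentzian`.

## Source (verbatim) — [BrandenHuh2019] P. Brändén, J. Huh, *Lorentzian polynomials*, Ann. of Math. 192 (2020),
## arXiv:1902.03719 (held `paper:arxiv-1902.03719`), §2.2

**Theorem 2.10.** "If `f(w) ∈ L^d_n`, then `f(Av) ∈ L^d_m` for any `n × m` matrix `A` with nonnegative entries." Proof:
"Note that Theorem 2.10 follows from its three special cases: (I) the elementary splitting
`f(w_1, …, w_{n-1}, w_n + w_{n+1})` is in `L^d_{n+1}`, (II) the dilation `f(w_1, …, w_{n-1}, θ w_n)` is in `L^d_n` for any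
`θ ≥ 0`, (III) the diagonalization `f(w_1, …, w_{n-2}, w_{n-1}, w_{n-1})` is in `L^d_{n-1}`. As observed in the proof of
Lemma 2.8, an elementary splitting preserves M-convexity: `f(w_1, …, w_{n-1}, w_n + w_{n+1}) ∈ M^d_{n+1}`."

## What is proved, and how

Every nonnegative `A : σ × τ → ℝ_{≥0}` factors as a WEIGHTED SPLITTING followed by an IDENTIFICATION:
`f(Av) = rename snd (splitSubst fst A f)`, where `splitSubst ψ c f = f(w_i ↦ Σ_{e ∈ ψ⁻¹(i)} c_e X_e)` splits each variable
`w_i` into the new variables `X_e`, `e ∈ ψ⁻¹(i)`, with nonnegative weights `c_e` (Brändén–Huh's (I) + (II): the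
elementary splitting is `ψ : [n+1] → [n]`, `c ≡ 1`; a dilation is `ψ = id`) and `rename snd` (their (III), in the
general form of `Diagonalization.lean`, g28-#5) identifies the copies. §§1–3 show `splitSubst` preserves `L^d`: the
chain rule `∂_e (splitSubst f) = c_e · splitSubst (∂_{ψ(e)} f)` (`pderiv_splitSubst`) and its iterate, homogeneity, the
normalized coefficients `c_ζ(splitSubst f) = c^ζ · c_{ψ_* ζ}(f)` (so the support is the SPLITTING `ψ^*(supp f)` cut by
the coordinate face `{ζ_e = 0 : c_e = 0}` — M-convex by `IsMConvex.preimage_mapDomain`, g28-#2, and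
`IsMConvex.sep_apply_eq_zero`), and the Hessian of `splitSubst q`, `q` quadratic, as a pull-back of that of `q`
(`toBilin'_hessian_splitSubst`); **`splitSubst_mem_lorentzian`**. §4: **`linearSubst_mem_lorentzian`** — Theorem 2.10.
-/

noncomputable section

open MvPolynomial Finsupp Finset Matrix
open Literature.LinearAlgebra.QuadraticForm

namespace Literature.Combinatorics.LorentzianPolynomials

variable {σ τ E : Type*} [Fintype σ] [Fintype τ] [Fintype E]

/-! ## §1 The weighted splitting `splitSubst ψ c f = f(w_i ↦ Σ_{ψ(e) = i} c_e X_e)` and its chain rule -/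

section Split

variable [DecidableEq σ]

/-- The linear form `L_i = Σ_{e ∈ ψ⁻¹(i)} c_e X_e` substituted for `w_i`. [cite: BrandenHuh2019, §2.2 proof of Thm. 2.10
((I) "`w_n + w_{n+1}`", (II) "`θ w_n`")] -/
def splitForm (ψ : E → σ) (c : E → ℝ) (i : σ) : MvPolynomial E ℝ := ∑ e ∈ univ.filter (fun e ↦ ψ e = i), c e • X e

/-- **The weighted splitting of variables** `splitSubst ψ c f = f(w_i ↦ Σ_{ψ(e) = i} c_e X_e)`: every variable `w_i` is
replaced by a nonnegative combination of the new variables over `i` (Brändén–Huh's elementary splitting (I) composed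
with dilations (II)). [cite: BrandenHuh2019, §2.2 proof of Thm. 2.10 ((I), (II))] -/
def splitSubst (ψ : E → σ) (c : E → ℝ) (f : MvPolynomial σ ℝ) : MvPolynomial E ℝ := bind₁ (splitForm ψ c) f

omit [Fintype σ] in
/-- `∂_e L_i = [ψ e = i] c_e`. [cite: BrandenHuh2019, §2.2 proof of Thm. 2.10] -/
theorem pderiv_splitForm [DecidableEq E] (ψ : E → σ) (c : E → ℝ) (i : σ) (e : E) :
    pderiv e (splitForm ψ c i) = if ψ e = i then c e • (1 : MvPolynomial E ℝ) else 0 := by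
  rw [splitForm, map_sum]
  simp_rw [(pderiv e).map_smul, pderiv_X, Pi.single_apply, smul_ite, smul_zero]
  simp only [Finset.sum_ite_eq', Finset.mem_filter, Finset.mem_univ, true_and]

omit [Fintype σ] in
/-- `L_i` is homogeneous of degree `1`. [cite: BrandenHuh2019, §2.2 proof of Thm. 2.10] -/
theorem isHomogeneous_splitForm (ψ : E → σ) (c : E → ℝ) (i : σ) : (splitForm ψ c i).IsHomogeneous 1 := by
  refine IsHomogeneous.sum _ _ _ fun e _ ↦ ?_
  rw [smul_eq_C_mul]
  simpa using (isHomogeneous_C E (c e)).mul (isHomogeneous_X ℝ e)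

omit [Fintype σ] in
/-- `L_i(x) = Σ_{ψ(e)=i} c_e x_e`. [cite: BrandenHuh2019, §2.2 proof of Thm. 2.10] -/
theorem eval_splitForm (ψ : E → σ) (c : E → ℝ) (i : σ) (x : E → ℝ) :
    eval x (splitForm ψ c i) = ∑ e ∈ univ.filter (fun e ↦ ψ e = i), c e * x e := by
  rw [splitForm, map_sum]
  exact Finset.sum_congr rfl fun e _ ↦ by rw [smul_eq_C_mul, map_mul, eval_C, eval_X]

omit [Fintype σ] in
/-- `splitSubst` is additive. [cite: BrandenHuh2019, §2.2 Thm. 2.10] -/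
theorem splitSubst_add (ψ : E → σ) (c : E → ℝ) (f g : MvPolynomial σ ℝ) :
    splitSubst ψ c (f + g) = splitSubst ψ c f + splitSubst ψ c g := map_add _ _ _

omit [Fintype σ] in
/-- `splitSubst` is `ℝ`-linear. [cite: BrandenHuh2019, §2.2 Thm. 2.10] -/
theorem splitSubst_smul (ψ : E → σ) (c : E → ℝ) (a : ℝ) (f : MvPolynomial σ ℝ) :
    splitSubst ψ c (a • f) = a • splitSubst ψ c f := by
  rw [splitSubst, splitSubst, smul_eq_C_mul, map_mul, bind₁_C_right, smul_eq_C_mul]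

omit [Fintype σ] in
/-- `splitSubst 0 = 0`. [cite: BrandenHuh2019, §2.2 Thm. 2.10] -/
theorem splitSubst_zero (ψ : E → σ) (c : E → ℝ) : splitSubst ψ c (0 : MvPolynomial σ ℝ) = 0 := map_zero _

omit [Fintype σ] in
/-- `splitSubst (C a) = C a`. [cite: BrandenHuh2019, §2.2 Thm. 2.10] -/
theorem splitSubst_C (ψ : E → σ) (c : E → ℝ) (a : ℝ) : splitSubst ψ c (C a : MvPolynomial σ ℝ) = C a :=
  bind₁_C_right _ _

omit [Fintype σ] in
/-- `splitSubst (p · X_i) = splitSubst p · L_i`. [cite: BrandenHuh2019, §2.2 Thm. 2.10] -/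
theorem splitSubst_mul_X (ψ : E → σ) (c : E → ℝ) (p : MvPolynomial σ ℝ) (i : σ) :
    splitSubst ψ c (p * X i) = splitSubst ψ c p * splitForm ψ c i := by
  rw [splitSubst, splitSubst, map_mul, bind₁_X_right]

omit [Fintype σ] in
/-- **Chain rule for the weighted splitting**: `∂_e (f ∘ split) = c_e · (∂_{ψ(e)} f) ∘ split`.
[cite: BrandenHuh2019, §2.2 proof of Thm. 2.10 ((I), (II))] -/
theorem pderiv_splitSubst [DecidableEq E] (ψ : E → σ) (c : E → ℝ) (e : E) (f : MvPolynomial σ ℝ) :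
    pderiv e (splitSubst ψ c f) = c e • splitSubst ψ c (pderiv (ψ e) f) := by
  induction f using MvPolynomial.induction_on with
  | C a => rw [splitSubst_C, pderiv_C, pderiv_C, splitSubst_zero, smul_zero]
  | add p q hp hq => rw [splitSubst_add, map_add, hp, hq, map_add, splitSubst_add, smul_add]
  | mul_X p i hp =>
    rw [splitSubst_mul_X, pderiv_mul, hp, pderiv_splitForm, pderiv_mul, splitSubst_add, splitSubst_mul_X, pderiv_X,
      smul_add, smul_mul_assoc]
    congr 1
    rw [Pi.single_apply]
    by_cases h : ψ e = i
    · rw [if_pos h, if_pos h.symm, mul_one, mul_smul_comm, mul_one]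
    · rw [if_neg h, if_neg (Ne.symm h), mul_zero, mul_zero, splitSubst_zero, smul_zero]

/-- `Π_{e'} c_{e'}^{(ζ + e_e)_{e'}} = (Π_{e'} c_{e'}^{ζ_{e'}}) · c_e`. [cite: BrandenHuh2019, §2.2 proof of Thm. 2.10 (II)] -/
private theorem prod_pow_add_single [DecidableEq E] (c : E → ℝ) (ζ : E →₀ ℕ) (e : E) :
    ∏ e', c e' ^ (ζ + Finsupp.single e 1 : E →₀ ℕ) e' = (∏ e', c e' ^ ζ e') * c e := by
  simp_rw [Finsupp.add_apply, pow_add, Finset.prod_mul_distrib]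
  congr 1
  rw [Finset.prod_eq_single e (fun e' _ hne ↦ by rw [Finsupp.single_eq_of_ne hne, pow_zero])
    (fun h ↦ absurd (Finset.mem_univ e) h), Finsupp.single_eq_same, pow_one]

/-- **Iterated chain rule**: `∂^ζ (f ∘ split) = c^ζ · (∂^{ψ_* ζ} f) ∘ split`, `c^ζ = Π_e c_e^{ζ_e}`.
[cite: BrandenHuh2019, §2.2 proof of Thm. 2.10] -/
theorem iterPderiv_splitSubst [DecidableEq E] (ψ : E → σ) (c : E → ℝ) :
    ∀ (n : ℕ) {ζ : E →₀ ℕ} (f : MvPolynomial σ ℝ), ζ.degree = n →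
      iterPderiv ζ (splitSubst ψ c f) = (∏ e, c e ^ ζ e) • splitSubst ψ c (iterPderiv (Finsupp.mapDomain ψ ζ) f)
  | 0, ζ, f, hζ => by
    rw [Finsupp.degree_eq_zero_iff] at hζ
    subst hζ
    simp
  | n + 1, ζ, f, hζ => by
    have hζ0 : ζ ≠ 0 := by intro h0; rw [h0, map_zero] at hζ; exact Nat.succ_ne_zero n hζ.symm
    obtain ⟨e, he⟩ := Finsupp.ne_iff.1 hζ0
    rw [Finsupp.coe_zero, Pi.zero_apply] at he
    obtain ⟨ζ', rfl⟩ : ∃ ζ', ζ = ζ' + Finsupp.single e 1 :=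
      ⟨ζ - Finsupp.single e 1, (Finsupp.sub_add_single_one_cancel he).symm⟩
    have hdeg : ζ'.degree = n := by rw [map_add, Finsupp.degree_single] at hζ; omega
    rw [iterPderiv_add_single', pderiv_splitSubst, iterPderiv_smul, iterPderiv_splitSubst ψ c n _ hdeg,
      iterPderiv_pderiv, smul_smul, Finsupp.mapDomain_add, Finsupp.mapDomain_single, prod_pow_add_single, mul_comm]

end Split

/-! ## §2 Homogeneity, normalized coefficients and support of the weighted splitting -/

section SplitCoeff

variable [DecidableEq σ]

omit [Fintype σ] [Fintype E] in
/-- A power of a linear form is homogeneous. [cite: BrandenHuh2019, §2.1 (p. 8, `H^d_n`)] -/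
private theorem isHomogeneous_pow_of_one {p : MvPolynomial E ℝ} (hp : p.IsHomogeneous 1) :
    ∀ n : ℕ, (p ^ n).IsHomogeneous n
  | 0 => by rw [pow_zero]; exact isHomogeneous_one E ℝ
  | n + 1 => by rw [pow_succ]; exact (isHomogeneous_pow_of_one hp n).mul hp

omit [Fintype σ] in
/-- **`splitSubst` preserves homogeneity** (each `w_i` is replaced by a linear form). [cite: BrandenHuh2019, §2.2 Thm.
2.10 (`f(Av) ∈ H^d_m`)] -/
theorem isHomogeneous_splitSubst (ψ : E → σ) (c : E → ℝ) {f : MvPolynomial σ ℝ} {d : ℕ} (hf : f.IsHomogeneous d) :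
    (splitSubst ψ c f).IsHomogeneous d := by
  have h : splitSubst ψ c f = ∑ α ∈ f.support, C (coeff α f) * ∏ i ∈ α.support, splitForm ψ c i ^ α i := by
    conv_lhs => rw [splitSubst, f.as_sum, map_sum]
    exact Finset.sum_congr rfl fun α _ ↦ bind₁_monomial _ _ _
  rw [h]
  refine IsHomogeneous.sum _ _ _ fun α hα ↦ ?_
  have hαd : α.degree = d := by
    by_contra hne
    exact (MvPolynomial.mem_support_iff.1 hα) (hf.coeff_eq_zero hne)
  have hprod := IsHomogeneous.prod α.support (fun i ↦ splitForm ψ c i ^ α i) (fun i ↦ α i)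
    fun i _ ↦ isHomogeneous_pow_of_one (isHomogeneous_splitForm ψ c i) (α i)
  have := (isHomogeneous_C E (coeff α f)).mul hprod
  rwa [zero_add, ← Finsupp.degree_apply, hαd] at this

omit [DecidableEq σ] in
/-- `∂^α f = c_α(f)` (a constant) for `|α| = deg f`. [cite: BrandenHuh2019, §2.2 (p. 11, normalized coefficients)] -/
theorem iterPderiv_eq_C_normCoeff {f : MvPolynomial σ ℝ} {d : ℕ} (hf : f.IsHomogeneous d) {α : σ →₀ ℕ}
    (hα : α.degree = d) : iterPderiv α f = C (normCoeff α f) := by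
  have h0 : (iterPderiv α f).IsHomogeneous 0 := IsHomogeneous.iterPderiv α (by rwa [zero_add, hα])
  rw [totalDegree_eq_zero_iff_eq_C.1 (Nat.le_zero.1 h0.totalDegree_le)]
  congr 1
  rw [← one_mul (coeff 0 _), ← factorialProd_zero (σ := σ), ← normCoeff_def, normCoeff_iterPderiv, add_zero]

/-- **`c_ζ(f ∘ split) = c^ζ · c_{ψ_* ζ}(f)`** for `|ζ| = d`: the normalized coefficients of the weighted splitting.
[cite: BrandenHuh2019, §2.2 proof of Thm. 2.10 and Lemma 2.8 ("the support of `g` is obtained from the support of `f`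
by an elementary splitting")] -/
theorem normCoeff_splitSubst [DecidableEq E] (ψ : E → σ) (c : E → ℝ) {f : MvPolynomial σ ℝ} {d : ℕ}
    (hf : f.IsHomogeneous d) {ζ : E →₀ ℕ} (hζ : ζ.degree = d) :
    normCoeff ζ (splitSubst ψ c f) = (∏ e, c e ^ ζ e) * normCoeff (Finsupp.mapDomain ψ ζ) f := by
  have h1 : normCoeff ζ (splitSubst ψ c f) = coeff 0 (iterPderiv ζ (splitSubst ψ c f)) := by
    rw [← one_mul (coeff 0 _), ← factorialProd_zero (σ := E), ← normCoeff_def, normCoeff_iterPderiv, add_zero]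
  rw [h1, iterPderiv_splitSubst ψ c _ f hζ, iterPderiv_eq_C_normCoeff hf (by rw [Finsupp.degree_mapDomain, hζ]),
    splitSubst_C, coeff_smul, coeff_zero_C, smul_eq_mul]

/-- The coefficients of the weighted splitting of an `f` with nonnegative coefficients are nonnegative (`c ≥ 0`).
[cite: BrandenHuh2019, §2.2 Thm. 2.10] -/
theorem coeff_splitSubst_nonneg [DecidableEq E] (ψ : E → σ) {c : E → ℝ} (hc : ∀ e, 0 ≤ c e) {f : MvPolynomial σ ℝ}
    {d : ℕ} (hf : f.IsHomogeneous d) (hnn : ∀ α, 0 ≤ coeff α f) (ζ : E →₀ ℕ) : 0 ≤ coeff ζ (splitSubst ψ c f) := by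
  by_cases hζ : ζ.degree = d
  · rw [← normCoeff_nonneg_iff, normCoeff_splitSubst ψ c hf hζ]
    exact mul_nonneg (Finset.prod_nonneg fun e _ ↦ pow_nonneg (hc e) _) (normCoeff_nonneg_iff.2 (hnn _))
  · rw [(isHomogeneous_splitSubst ψ c hf).coeff_eq_zero hζ]

/-- **The support of the weighted splitting is the splitting `ψ^*(supp f)` of the support, cut by the coordinate face
of the zero weights.** [cite: BrandenHuh2019, §2.2 Lemma 2.8 (proof, "elementary splitting" and "the intersection of an
M-convex set with a cartesian product of intervals") and proof of Thm. 2.10 ((I), (II))] -/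
theorem support_splitSubst [DecidableEq E] (ψ : E → σ) (c : E → ℝ) {f : MvPolynomial σ ℝ} {d : ℕ}
    (hf : f.IsHomogeneous d) :
    {ζ | coeff ζ (splitSubst ψ c f) ≠ 0} =
      {ζ : E →₀ ℕ | ζ ∈ {ζ | Finsupp.mapDomain ψ ζ ∈ {α | coeff α f ≠ 0}} ∧ ∀ e ∈ {e | c e = 0}, ζ e = 0} := by
  ext ζ
  simp only [Set.mem_setOf_eq]
  by_cases hζ : ζ.degree = d
  · rw [ne_eq, ← normCoeff_eq_zero_iff, normCoeff_splitSubst ψ c hf hζ, mul_eq_zero, not_or, normCoeff_eq_zero_iff,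
      Finset.prod_eq_zero_iff]
    push Not
    constructor
    · rintro ⟨hprod, hcoeff⟩
      refine ⟨hcoeff, fun e he ↦ ?_⟩
      by_contra hζe
      exact hprod e (Finset.mem_univ e) (by rw [he, zero_pow hζe])
    · rintro ⟨hcoeff, hzero⟩
      refine ⟨fun e _ h0 ↦ ?_, hcoeff⟩
      have hζe : ζ e ≠ 0 := fun h' ↦ by rw [h', pow_zero] at h0; exact one_ne_zero h0
      exact hζe (hzero e ((pow_eq_zero_iff hζe).1 h0))
  · have h1 : coeff ζ (splitSubst ψ c f) = 0 := (isHomogeneous_splitSubst ψ c hf).coeff_eq_zero hζ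
    have h2 : coeff (Finsupp.mapDomain ψ ζ) f = 0 := hf.coeff_eq_zero (by rwa [Finsupp.degree_mapDomain])
    simp [h1, h2]

end SplitCoeff

/-! ## §3 The Hessian of the weighted splitting of a quadratic form; `splitSubst` preserves `L^d` -/

section SplitLorentzian

variable [DecidableEq σ] [DecidableEq E]

omit [Fintype σ] [DecidableEq E] in
/-- **The split map** `x ↦ (Σ_{ψ(e)=i} c_e x_e)_i` on vectors (the matrix `A` of the substitution). [cite: BrandenHuh2019,
§2.2 Thm. 2.10 ("`f(Av)`")] -/
def splitMap (ψ : E → σ) (c : E → ℝ) : (E → ℝ) →ₗ[ℝ] (σ → ℝ) where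
  toFun x := fun i ↦ ∑ e ∈ univ.filter (fun e ↦ ψ e = i), c e * x e
  map_add' x y := by ext i; simp only [Pi.add_apply, mul_add, Finset.sum_add_distrib]
  map_smul' a x := by ext i; simp only [Pi.smul_apply, smul_eq_mul, RingHom.id_apply, Finset.mul_sum, mul_left_comm]

omit [Fintype σ] [DecidableEq E] in
/-- `(f ∘ split)(x) = f(Ax)`. [cite: BrandenHuh2019, §2.2 Thm. 2.10 ("`f(Av)`")] -/
theorem eval_splitSubst (ψ : E → σ) (c : E → ℝ) (f : MvPolynomial σ ℝ) (x : E → ℝ) :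
    eval x (splitSubst ψ c f) = eval (splitMap ψ c x) f := by
  have hg : (fun j ↦ eval x (splitForm ψ c j)) = splitMap ψ c x := by
    funext i; rw [eval_splitForm]; rfl
  rw [splitSubst, show eval x (bind₁ (splitForm ψ c) f) = eval (fun j ↦ eval x (splitForm ψ c j)) f from
    eval₂Hom_bind₁ _ _ _ _, hg]

/-- **The Hessian form of the weighted splitting of a quadratic form `q` is the pull-back of that of `q` along the split
map**: `xᵀ 𝓗_{q∘split} y = (Ax)ᵀ 𝓗_q (Ay)`. [cite: BrandenHuh2019, §2.1 Lemma 2.5; §2.2 Thm. 2.10] -/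
theorem toBilin'_hessian_splitSubst (ψ : E → σ) (c : E → ℝ) {q : MvPolynomial σ ℝ} (hq : q.IsHomogeneous 2)
    (x y : E → ℝ) :
    Matrix.toBilin' (hessian (splitSubst ψ c q)) x y = Matrix.toBilin' (hessian q) (splitMap ψ c x) (splitMap ψ c y) := by
  have hq' : (splitSubst ψ c q).IsHomogeneous 2 := isHomogeneous_splitSubst ψ c hq
  have hdiag : ∀ z : E → ℝ, Matrix.toBilin' (hessian (splitSubst ψ c q)) z z =
      Matrix.toBilin' (hessian q) (splitMap ψ c z) (splitMap ψ c z) := fun z ↦ by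
    rw [← two_mul_eval_eq_toBilin'_hessian hq', ← two_mul_eval_eq_toBilin'_hessian hq, eval_splitSubst]
  have hs' := isSymm_toBilin'_hessian (splitSubst ψ c q)
  have hs := isSymm_toBilin'_hessian q
  have h1 := hdiag (x + y)
  rw [map_add] at h1
  simp only [map_add, LinearMap.add_apply] at h1
  rw [hdiag x, hdiag y, symm_apply hs' y x, symm_apply hs (splitMap ψ c y) (splitMap ψ c x)] at h1
  linarith

/-- The positive index of `𝓗_{q ∘ split}` does not exceed that of `𝓗_q`. [cite: BrandenHuh2019, §2.2 Thm. 2.10]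
[cite: Serre1973, Ch. V §1.3.2] -/
theorem sigPos_hessian_splitSubst_le (ψ : E → σ) (c : E → ℝ) {q : MvPolynomial σ ℝ} (hq : q.IsHomogeneous 2) :
    sigPos (Matrix.toBilin' (hessian (splitSubst ψ c q))).toQuadraticMap ≤
      sigPos (Matrix.toBilin' (hessian q)).toQuadraticMap :=
  LinearMap.BilinForm.sigPos_le_sigPos_of_comp _ _ (splitMap ψ c) fun x y ↦ by rw [toBilin'_hessian_splitSubst ψ c hq]

/-- **The weighted splitting preserves Lorentzian polynomials** (Brändén–Huh Thm. 2.10 (I) + (II), general form): for any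
`ψ : E → σ`, weights `c ≥ 0` and `f ∈ L^d_σ`, `f(w_i ↦ Σ_{ψ(e)=i} c_e X_e) ∈ L^d_E`. Support: the splitting of `supp f`
cut by a coordinate face (`IsMConvex.preimage_mapDomain`, `IsMConvex.sep_apply_eq_zero`); Hessians: `∂^ζ` of the
splitting is `c^ζ` times the splitting of `∂^{ψ_*ζ} f ∈ L²`, a pull-back. [cite: BrandenHuh2019, §2.2 Thm. 2.10 ((I),
(II)) and Lemma 2.8] -/
theorem splitSubst_mem_lorentzian (ψ : E → σ) {c : E → ℝ} (hc : ∀ e, 0 ≤ c e) :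
    ∀ {d : ℕ} {f : MvPolynomial σ ℝ}, f ∈ lorentzian σ d → splitSubst ψ c f ∈ lorentzian E d
  | 0, _, hf => mem_lorentzian_zero.2 ⟨isHomogeneous_splitSubst ψ c (mem_lorentzian_zero.1 hf).1,
      coeff_splitSubst_nonneg ψ hc (mem_lorentzian_zero.1 hf).1 (mem_lorentzian_zero.1 hf).2⟩
  | 1, _, hf => mem_lorentzian_one.2 ⟨isHomogeneous_splitSubst ψ c (mem_lorentzian_one.1 hf).1,
      coeff_splitSubst_nonneg ψ hc (mem_lorentzian_one.1 hf).1 (mem_lorentzian_one.1 hf).2⟩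
  | m + 2, f, hf => by
    have hhom := isHomogeneous_of_mem_lorentzian hf
    have hnn := coeff_nonneg_of_mem_lorentzian hf
    refine mem_lorentzian_iff_forall_sigPos_hessian.2
      ⟨⟨isHomogeneous_splitSubst ψ c hhom, coeff_splitSubst_nonneg ψ hc hhom hnn, ?_⟩, fun ζ hζ ↦ ?_⟩
    · rw [support_splitSubst ψ c hhom]
      exact ((isMConvex_support_of_mem_lorentzian hf).preimage_mapDomain ψ).sep_apply_eq_zero {e | c e = 0}
    · rw [iterPderiv_splitSubst ψ c m f hζ, hessian_smul, map_smul]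
      have h2 : iterPderiv (Finsupp.mapDomain ψ ζ) f ∈ lorentzian σ 2 :=
        iterPderiv_mem_lorentzian (by rwa [Finsupp.degree_mapDomain, hζ, add_comm])
      rcases (Finset.prod_nonneg fun e (_ : e ∈ univ) ↦ pow_nonneg (hc e) (ζ e)).eq_or_lt with h0 | hpos
      · rw [← h0, zero_smul]
        have hz := (mem_lorentzian_two.1 (zero_mem_lorentzian (σ := E) 2)).2.2.2
        have hh : hessian (0 : MvPolynomial E ℝ) = 0 := by ext i j; simp [hessian_apply]
        rwa [hh, map_zero] at hz
      · rw [sigPos_smul_of_pos _ hpos]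
        exact (sigPos_hessian_splitSubst_le ψ c (isHomogeneous_of_mem_lorentzian h2)).trans
          (mem_lorentzian_two.1 h2).2.2.2

end SplitLorentzian

/-! ## §4 Theorem 2.10: `f(Av) ∈ L^d_m` -/

section LinearSubst

variable [DecidableEq σ] [DecidableEq τ]

/-- **The nonnegative linear change of variables `f(Av)`**: `w_i ↦ Σ_k A_{ik} v_k`. [cite: BrandenHuh2019, §2.2 Thm. 2.10
("`f(Av)` […] for any `n × m` matrix `A`")] -/
def linearSubst (A : σ → τ → ℝ) (f : MvPolynomial σ ℝ) : MvPolynomial τ ℝ := bind₁ (fun i ↦ ∑ k, A i k • X k) f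

omit [DecidableEq τ] in
/-- `f(Av)` is the weighted splitting along `fst : σ × τ → σ` with weights `A`, followed by the identification
`snd : σ × τ → τ` of the copies. [cite: BrandenHuh2019, §2.2 proof of Thm. 2.10 ("Theorem 2.10 follows from its three
special cases")] -/
theorem linearSubst_eq_rename_splitSubst (A : σ → τ → ℝ) (f : MvPolynomial σ ℝ) :
    linearSubst A f = rename Prod.snd (splitSubst (Prod.fst : σ × τ → σ) (fun p ↦ A p.1 p.2) f) := by
  have hg : (fun i ↦ rename (Prod.snd : σ × τ → τ) (splitForm (Prod.fst : σ × τ → σ) (fun p ↦ A p.1 p.2) i)) =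
      fun i ↦ ∑ k, A i k • (X k : MvPolynomial τ ℝ) := by
    funext i
    simp only [splitForm, map_sum, map_smul, rename_X]
    rw [Finset.sum_filter, Fintype.sum_prod_type, Finset.sum_eq_single i]
    · exact Finset.sum_congr rfl fun k _ ↦ if_pos rfl
    · intro j _ hji
      exact Finset.sum_eq_zero fun k _ ↦ if_neg hji
    · intro h; exact absurd (Finset.mem_univ i) h
  rw [linearSubst, splitSubst, rename_bind₁, hg]

omit [Fintype σ] [DecidableEq σ] [DecidableEq τ] in
/-- `(f(Av))(v) = f(Av)`: evaluation. [cite: BrandenHuh2019, §2.2 Thm. 2.10] -/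
theorem eval_linearSubst (A : σ → τ → ℝ) (f : MvPolynomial σ ℝ) (v : τ → ℝ) :
    eval v (linearSubst A f) = eval (fun i ↦ ∑ k, A i k * v k) f := by
  have hg : (fun j ↦ eval v (∑ k, A j k • X k : MvPolynomial τ ℝ)) = fun i ↦ ∑ k, A i k * v k := by
    funext i
    rw [map_sum]
    exact Finset.sum_congr rfl fun k _ ↦ by rw [smul_eq_C_mul, map_mul, eval_C, eval_X]
  rw [linearSubst, show eval v (bind₁ (fun i ↦ ∑ k, A i k • X k) f) =
    eval (fun j ↦ eval v (∑ k, A j k • X k)) f from eval₂Hom_bind₁ _ _ _ _, hg]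

/-- **Brändén–Huh, Theorem 2.10: "If `f(w) ∈ L^d_n`, then `f(Av) ∈ L^d_m` for any `n × m` matrix `A` with nonnegative
entries."** (For the tree's Definition-2.6 `lorentzian`; `linearSubst A f = f(w_i ↦ Σ_k A_{ik} v_k)`.) As in the printed
proof, from splitting + dilation (`splitSubst_mem_lorentzian`) and diagonalization (`rename_mem_lorentzian_of_any`).
[cite: BrandenHuh2019, §2.2 Thm. 2.10] -/
theorem linearSubst_mem_lorentzian {A : σ → τ → ℝ} (hA : ∀ i k, 0 ≤ A i k) {d : ℕ} {f : MvPolynomial σ ℝ}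
    (hf : f ∈ lorentzian σ d) : linearSubst A f ∈ lorentzian τ d := by
  rw [linearSubst_eq_rename_splitSubst]
  have h1 : splitSubst (Prod.fst : σ × τ → σ) (fun p : σ × τ ↦ A p.1 p.2) f ∈ lorentzian (σ × τ) d :=
    splitSubst_mem_lorentzian (E := σ × τ) Prod.fst (c := fun p : σ × τ ↦ A p.1 p.2) (fun p ↦ hA p.1 p.2) hf
  exact rename_mem_lorentzian_of_any (σ := σ × τ) (τ := τ) Prod.snd h1

/-- **Theorem 2.10 (I), the elementary splitting as printed**: `f(w_1, …, w_{n-1}, w_n + w_{n+1}) ∈ L^d_{n+1}` — here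
`w_n ↦ w_n + w_{new}` with the new variable `none : Option σ`. [cite: BrandenHuh2019, §2.2 Thm. 2.10 (I)] -/
theorem splitting_mem_lorentzian (n : σ) {d : ℕ} {f : MvPolynomial σ ℝ} (hf : f ∈ lorentzian σ d) :
    bind₁ (fun i ↦ if i = n then X (some n) + X none else X (some i) : σ → MvPolynomial (Option σ) ℝ) f ∈
      lorentzian (Option σ) d := by
  have h := linearSubst_mem_lorentzian (A := fun i (o : Option σ) ↦
    o.elim (if i = n then (1 : ℝ) else 0) fun j ↦ if j = i then 1 else 0)
    (fun i o ↦ by cases o <;> simp only [Option.elim] <;> split_ifs <;> norm_num) hf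
  have hfun : (fun i ↦ if i = n then X (some n) + X none else X (some i) : σ → MvPolynomial (Option σ) ℝ) =
      fun i ↦ ∑ k : Option σ, (k.elim (if i = n then (1 : ℝ) else 0) fun j ↦ if j = i then 1 else 0) • X k := by
    funext i
    rw [Fintype.sum_option]
    simp only [Option.elim, ite_smul, one_smul, zero_smul, Finset.sum_ite_eq', Finset.mem_univ, if_true]
    split_ifs with hi
    · rw [hi, add_comm]
    · rw [zero_add]
  rw [hfun]
  exact h

end LinearSubst

end Literature.Combinatorics.LorentzianPolynomials

end
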